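import Literature.Analysis.FluidPDE.TaoAveragedSlotBounds
import Literature.Analysis.FluidPDE.TaoAveragedRealParts
import HarnessLib

/-!
# The slot operators `Rot_R`, `Dil_λ`, `m(D)` on `H¹⁰_df(ℝ³)` and `H¹⁰_df ⊗ ℂ`

T. Tao, *Finite time blowup for an averaged three-dimensional Navier–Stokes equation*,
J. Amer. Math. Soc. **29** (2016), 601–674 = arXiv:1402.0290v3, §1.1 p. 6: "if `u ∈ H¹⁰_df(ℝ³)`
and `R ∈ SO(3)` … then `Rot_R(u)` is also in `H¹⁰_df(ℝ³)`"; "these rotation operators are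
uniformly bounded on `H¹⁰_df`"; dilations "do not quite preserve the `H¹⁰_df` norm, but if `λ`
is restricted to a compact subset of `(0,+∞)` then these operators … will be uniformly
bounded"; real multipliers of order `0` "map `H¹⁰_df(ℝ³)` to itself".

Built on the accepted `TaoAveragedSlotFourier.lean` (`fourierFn_rot`, `fourierFn_dil`,
`complexifyCLM_apply`, `norm_complexifyCLM`), `TaoAveragedSlotBounds.lean` (the weighted-integral
bounds `sobolevWeightIntegral_fourierFn_rot`, `sobolevWeightIntegral_fourierFn_dil_le`,
`sobolevWeightIntegral_fourierMultiplier_le`), `TaoAveragedConjugation.lean`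
(`sobolevWeightIntegral`, `fourier_conjL2`) and `TaoAveragedRealParts.lean` (`IsReal.conjL2_eq`),
this file records the `H^s`-**norm** behaviour of the three operators composing a slot
`m(D) ∘ Rot_R ∘ Dil_λ` of (1.12)/(3.4) and the resulting closure properties of `H¹⁰_df` and
`H¹⁰_df ⊗ ℂ` — infrastructure for the discharge of `complexAverage_linear_right`,
`complexAverage_isAveraged` and (normalisation step of §3.2) `localCascade_isComplexAverage`
(`TaoAveragedComplexAverage.lean`):

* `cdot_complexifyCLM`, `conj3_complexifyCLM` — the complexified rotation preserves the complex
  bilinear dot product and commutes with conjugation;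
* `eFourierSobolevNorm_rot` (`‖Rot_R u‖_{H^s} = ‖u‖_{H^s}`), `IsReal.rot`, `IsFourierDivFree.rot`,
  `MemH10df.rot`, `MemH10dfC.rot`;
* `eFourierSobolevNorm_dil_le` (`‖Dil_λ u‖_{H^s} ≤ max(1,λ)^s ‖u‖_{H^s}`, `s ≥ 0`, `λ > 0`),
  `IsFourierDivFree.dil`, `MemH10df.dil`, `MemH10dfC.dil`;
* `eFourierSobolevNorm_fourierMultiplier_le` (`‖m(D)u‖_{H^s} ≤ ‖m‖_{L^∞} ‖u‖_{H^s}`),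
  `IsFourierDivFree.fourierMultiplier`, `MemH10dfC.fourierMultiplier`, and for real symbols
  `IsReal.fourierMultiplier`, `MemH10df.fourierMultiplier` (via the conjugation symmetry of `𝓕`
  and Plancherel injectivity).

## References

* T. Tao, J. Amer. Math. Soc. 29 (2016), 601–674, §1.1 pp. 6–7, (1.10)–(1.11). Key `Tao2016AveragedNS`.
-/

noncomputable section

open MeasureTheory Set Filter FourierTransform
open scoped ENNReal NNReal SchwartzMap ComplexConjugate RealInnerProductSpace

namespace Literature.Analysis.FluidPDE.Tao2016

/-- Local notation for physical / frequency space `ℝ³`. -/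
local notation "ℝ³" => EuclideanSpace ℝ (Fin 3)
/-- Local notation for the complexified range `ℂ³`. -/
local notation "ℂ³" => EuclideanSpace ℂ (Fin 3)

open FunctionSpaces.EuclideanSpace (complexify complexify_apply)

/-! ### The complexified rotation and the bilinear dot product -/

/-- The complexified rotation matrix `R ⊗ 1 : ℂ³ →L[ℂ] ℂ³` acting on the values of a
complexified field (the `R` in `Rot_R u (x) = R u(R⁻¹ x)`). [cite: Tao2016AveragedNS, §1.1 p. 6] -/
abbrev rotMat (R : ℝ³ ≃ₗᵢ[ℝ] ℝ³) : ℂ³ →L[ℂ] ℂ³ :=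
  complexifyCLM R.toLinearIsometry.toContinuousLinearMap

/-- `‖(R ⊗ 1) z‖ₑ = ‖z‖ₑ`. [folklore] -/
theorem enorm_rotMat (R : ℝ³ ≃ₗᵢ[ℝ] ℝ³) (z : ℂ³) : ‖rotMat R z‖ₑ = ‖z‖ₑ := by
  rw [← ofReal_norm, ← ofReal_norm, norm_complexifyCLM]

/-- `(R ⊗ 1)(v ⊗ 1) = (R v) ⊗ 1`. [folklore] -/
theorem rotMat_complexify (R : ℝ³ ≃ₗᵢ[ℝ] ℝ³) (v : ℝ³) :
    rotMat R (complexify v) = complexify (R v) :=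
  complexifyCLM_complexify _ v

/-- `T ⊗ 1` commutes with conjugation (its matrix is real). [folklore] -/
theorem conj3_complexifyCLM (T : ℝ³ →L[ℝ] ℝ³) (z : ℂ³) :
    conj3 (complexifyCLM T z) = complexifyCLM T (conj3 z) := by
  ext i
  simp [complexifyCLM_apply, map_sum]

/-- `cdot` is additive in its first argument. [folklore] -/
theorem cdot_add_left (a b c : ℂ³) : cdot (a + b) c = cdot a c + cdot b c := by
  simp [cdot, add_mul, Finset.sum_add_distrib]

/-- `cdot` is homogeneous in its first argument. [folklore] -/
theorem cdot_smul_left (c : ℂ) (a b : ℂ³) : cdot (c • a) b = c * cdot a b := by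
  simp [cdot, Finset.mul_sum, mul_assoc]

/-- On real vectors `cdot` is the real inner product. [folklore] -/
theorem cdot_complexify (a b : ℝ³) : cdot (complexify a) (complexify b) = ((⟪a, b⟫ : ℝ) : ℂ) := by
  simp [cdot, complexify_apply, PiLp.inner_apply, mul_comm]

/-- `T ⊗ 1` acts as `T` on real and imaginary parts. [folklore] -/
theorem complexifyCLM_eq_re_add_im (T : ℝ³ →L[ℝ] ℝ³) (z : ℂ³) :
    complexifyCLM T z = complexify (T (WithLp.toLp 2 fun j => (z j).re)) +
      Complex.I • complexify (T (WithLp.toLp 2 fun j => (z j).im)) := by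
  conv_lhs => rw [← complexify_re_add_I_smul_complexify_im z]
  rw [map_add, map_smul, complexifyCLM_complexify, complexifyCLM_complexify]

/-- **`R ⊗ 1` preserves the complex bilinear dot product** for a linear isometry `R` of `ℝ³`:
`(R ⊗ 1) z · (R ⊗ 1) w = z · w`. [folklore] -/
theorem cdot_complexifyCLM (R : ℝ³ ≃ₗᵢ[ℝ] ℝ³) (z w : ℂ³) :
    cdot (rotMat R z) (rotMat R w) = cdot z w := by
  conv_rhs => rw [← complexify_re_add_I_smul_complexify_im z,
    ← complexify_re_add_I_smul_complexify_im w]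
  rw [rotMat, complexifyCLM_eq_re_add_im, complexifyCLM_eq_re_add_im]
  simp only [cdot_add_left, cdot_add_right, cdot_smul_left, cdot_smul_right, cdot_complexify,
    LinearIsometry.coe_toContinuousLinearMap, LinearIsometryEquiv.coe_toLinearIsometry,
    LinearIsometryEquiv.inner_map_map]

/-! ### Rotations preserve `H¹⁰_df` -/

/-- **`‖Rot_R u‖_{H^s} = ‖u‖_{H^s}`** ("these rotation operators are uniformly bounded on
`H¹⁰_df`", Tao p. 6; in fact isometric). [cite: Tao2016AveragedNS, §1.1 p. 6] -/
theorem eFourierSobolevNorm_rot (s : ℝ) (R : ℝ³ ≃ₗᵢ[ℝ] ℝ³) (u : L2C) :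
    FunctionSpaces.eFourierSobolevNorm s (rot R u) = FunctionSpaces.eFourierSobolevNorm s u := by
  rw [eFourierSobolevNorm_eq, eFourierSobolevNorm_eq, sobolevWeightIntegral_fourierFn_rot]

/-- `R ⊗ 1` maps real vectors to real vectors. [folklore] -/
theorem rotMat_im_eq_zero (R : ℝ³ ≃ₗᵢ[ℝ] ℝ³) {z : ℂ³} (hz : ∀ i, (z i).im = 0) (i : Fin 3) :
    (rotMat R z i).im = 0 := by
  rw [rotMat, complexifyCLM_apply, Complex.im_sum]
  refine Finset.sum_eq_zero fun j _ => ?_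
  rw [Complex.mul_im, Complex.ofReal_im, Complex.ofReal_re, hz j, mul_zero, zero_mul, add_zero]

/-- Rotations preserve realness. [folklore] -/
theorem IsReal.rot {u : L2C} (hu : IsReal u) (R : ℝ³ ≃ₗᵢ[ℝ] ℝ³) : IsReal (rot R u) := by
  unfold IsReal
  filter_upwards [coeFn_rot R u, R.symm.measurePreserving.quasiMeasurePreserving.ae hu]
    with x h1 h2
  intro i
  rw [h1]
  exact rotMat_im_eq_zero R h2 i

/-- Rotations preserve divergence-freeness (`ξ · R û(R⁻¹ξ) = R⁻¹ξ · û(R⁻¹ξ)`). [folklore] -/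
theorem IsFourierDivFree.rot {u : L2C} (hu : IsFourierDivFree u) (R : ℝ³ ≃ₗᵢ[ℝ] ℝ³) :
    IsFourierDivFree (rot R u) := by
  unfold IsFourierDivFree
  filter_upwards [fourierFn_rot R u, R.symm.measurePreserving.quasiMeasurePreserving.ae hu]
    with ξ h1 h2
  rw [h1]
  have hξ : complexify ξ = rotMat R (complexify (R.symm ξ)) := by
    rw [rotMat_complexify, LinearIsometryEquiv.apply_symm_apply]
  rw [hξ]
  exact (cdot_complexifyCLM R _ _).trans h2

/-- **Rotations preserve `H¹⁰_df(ℝ³)`** (Tao 2016, p. 6: "if `u ∈ H¹⁰_df(ℝ³)` and `R ∈ SO(3)`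
… then the rotated vector field `Rot_R(u)` is also in `H¹⁰_df(ℝ³)`"). [cite: Tao2016AveragedNS, §1.1 p. 6] -/
theorem MemH10df.rot {u : L2C} (hu : MemH10df u) (R : ℝ³ ≃ₗᵢ[ℝ] ℝ³) : MemH10df (rot R u) :=
  ⟨(eFourierSobolevNorm_rot 10 R u).trans_lt hu.1, hu.2.1.rot R, hu.2.2.rot R⟩

/-- Rotations preserve `H¹⁰_df ⊗ ℂ`. [folklore] -/
theorem MemH10dfC.rot {u : L2C} (hu : MemH10dfC u) (R : ℝ³ ≃ₗᵢ[ℝ] ℝ³) : MemH10dfC (rot R u) :=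
  ⟨(eFourierSobolevNorm_rot 10 R u).trans_lt hu.1, hu.2.rot R⟩

/-! ### Dilations and `H^s` -/

/-- **`‖Dil_λ u‖_{H^s} ≤ max(1,λ)^s ‖u‖_{H^s}`** for `s ≥ 0`, `λ > 0` (Tao 2016, p. 6: dilations
"do not quite preserve the `H¹⁰_df` norm, but if `λ` is restricted to a compact subset of
`(0,+∞)` then these operators … will be uniformly bounded"). [cite: Tao2016AveragedNS, §1.1 p. 6] -/
theorem eFourierSobolevNorm_dil_le {s : ℝ} (hs : 0 ≤ s) {c : ℝ} (hc : 0 < c) (u : L2C) :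
    FunctionSpaces.eFourierSobolevNorm s (dil c u) ≤
      ENNReal.ofReal ((max 1 c) ^ s) * FunctionSpaces.eFourierSobolevNorm s u := by
  rw [eFourierSobolevNorm_eq, eFourierSobolevNorm_eq]
  calc sobolevWeightIntegral s (fourierFn (dil c u)) ^ (1 / 2 : ℝ)
      ≤ (ENNReal.ofReal ((max 1 c ^ 2) ^ s) * sobolevWeightIntegral s (fourierFn u)) ^ (1 / 2 : ℝ) :=
        ENNReal.rpow_le_rpow (sobolevWeightIntegral_fourierFn_dil_le u hs hc) (by norm_num)
    _ = ENNReal.ofReal ((max 1 c) ^ s) * sobolevWeightIntegral s (fourierFn u) ^ (1 / 2 : ℝ) := by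
      have hm : (0 : ℝ) ≤ max 1 c := le_trans zero_le_one (le_max_left _ _)
      rw [ENNReal.mul_rpow_of_nonneg _ _ (by norm_num), ENNReal.ofReal_rpow_of_nonneg
        (by positivity) (by norm_num), ← Real.rpow_natCast, ← Real.rpow_mul hm, ← Real.rpow_mul hm]
      congr 3
      push_cast
      ring

/-- Dilations preserve divergence-freeness. [folklore] -/
theorem IsFourierDivFree.dil {u : L2C} (hu : IsFourierDivFree u) {c : ℝ} (hc : 0 < c) :
    IsFourierDivFree (dil c u) := by
  unfold IsFourierDivFree
  have hc' : c⁻¹ ≠ 0 := inv_ne_zero hc.ne'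
  filter_upwards [fourierFn_dil u hc, (Measure.quasiMeasurePreserving_smul volume hc').ae hu]
    with ξ h1 h2
  rw [h1, cdot_smul_right]
  have h3 : cdot (complexify ξ) (fourierFn u (c⁻¹ • ξ)) = 0 := by
    have h4 : complexify ξ = (c : ℂ) • complexify (c⁻¹ • ξ) := by
      ext i
      simp [complexify_apply, hc.ne']
    rw [h4, cdot_smul_left, h2, mul_zero]
  rw [h3, mul_zero]

/-- **Dilations preserve `H¹⁰_df(ℝ³)`** (`λ > 0`). [cite: Tao2016AveragedNS, §1.1 p. 6] -/
theorem MemH10df.dil {u : L2C} (hu : MemH10df u) {c : ℝ} (hc : 0 < c) : MemH10df (dil c u) :=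
  ⟨lt_of_le_of_lt (eFourierSobolevNorm_dil_le (by norm_num) hc u)
    (ENNReal.mul_lt_top ENNReal.ofReal_lt_top hu.1), isReal_dil hu.2.1 c, hu.2.2.dil hc⟩

/-- Dilations preserve `H¹⁰_df ⊗ ℂ` (`λ > 0`). [folklore] -/
theorem MemH10dfC.dil {u : L2C} (hu : MemH10dfC u) {c : ℝ} (hc : 0 < c) : MemH10dfC (dil c u) :=
  ⟨lt_of_le_of_lt (eFourierSobolevNorm_dil_le (by norm_num) hc u)
    (ENNReal.mul_lt_top ENNReal.ofReal_lt_top hu.1), hu.2.dil hc⟩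

/-! ### Fourier multipliers and `H^s`; real symbols preserve realness -/

/-- An `L^∞` symbol is a.e. bounded by its norm: `‖m(ξ)‖ₑ ≤ ‖m‖ₑ` a.e. [folklore] -/
theorem ae_enorm_le_enorm (m : Lp ℂ ∞ (volume : Measure ℝ³)) :
    ∀ᵐ ξ ∂(volume : Measure ℝ³), ‖(m : ℝ³ → ℂ) ξ‖ₑ ≤ ‖m‖ₑ := by
  rw [Lp.enorm_def, eLpNorm_exponent_top]
  exact ae_le_eLpNormEssSup

/-- **`‖m(D) u‖_{H^s} ≤ ‖m‖_{L^∞} ‖u‖_{H^s}`** (Plancherel: `\widehat{m(D)u} = m û`; Tao 2016,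
p. 6, the `L²`-Sobolev case of the boundedness of order-`0` multipliers, which needs no
Hörmander–Mikhlin theory). [cite: Tao2016AveragedNS, §1.1 p. 6] -/
theorem eFourierSobolevNorm_fourierMultiplier_le (s : ℝ) (m : Lp ℂ ∞ (volume : Measure ℝ³))
    (u : L2C) :
    FunctionSpaces.eFourierSobolevNorm s (fourierMultiplier m u) ≤
      ‖m‖ₑ * FunctionSpaces.eFourierSobolevNorm s u := by
  rw [eFourierSobolevNorm_eq, eFourierSobolevNorm_eq]
  calc sobolevWeightIntegral s (fourierFn (fourierMultiplier m u)) ^ (1 / 2 : ℝ)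
      ≤ (‖m‖ₑ ^ 2 * sobolevWeightIntegral s (fourierFn u)) ^ (1 / 2 : ℝ) :=
        ENNReal.rpow_le_rpow (sobolevWeightIntegral_fourierMultiplier_le s u (ae_enorm_le_enorm m))
          (by norm_num)
    _ = ‖m‖ₑ * sobolevWeightIntegral s (fourierFn u) ^ (1 / 2 : ℝ) := by
        rw [ENNReal.mul_rpow_of_nonneg _ _ (by norm_num), ← ENNReal.rpow_natCast,
          ← ENNReal.rpow_mul]
        norm_num

/-- A scalar Fourier multiplier preserves divergence-freeness (it commutes with `ξ ·`). [folklore] -/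
theorem IsFourierDivFree.fourierMultiplier {u : L2C} (hu : IsFourierDivFree u)
    (m : Lp ℂ ∞ (volume : Measure ℝ³)) : IsFourierDivFree (fourierMultiplier m u) := by
  unfold IsFourierDivFree at *
  filter_upwards [hu, fourierFn_fourierMultiplier m u] with ξ h1 h2
  rw [h2, cdot_smul_right, h1, mul_zero]

/-- `m(D)` maps `H¹⁰_df ⊗ ℂ` to itself for every `L^∞` symbol `m`. [cite: Tao2016AveragedNS, §1.1 p. 6] -/
theorem MemH10dfC.fourierMultiplier {u : L2C} (hu : MemH10dfC u)
    (m : Lp ℂ ∞ (volume : Measure ℝ³)) : MemH10dfC (fourierMultiplier m u) :=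
  ⟨lt_of_le_of_lt (eFourierSobolevNorm_fourierMultiplier_le 10 m u)
    (ENNReal.mul_lt_top enorm_lt_top hu.1), hu.2.fourierMultiplier m⟩

/-- A field fixed by conjugation is real (the converse of the tree's `IsReal.conjL2_eq`; one
half of `isReal_iff_conjL2_eq` of `TaoCascadeProjection.lean`, restated here to avoid the
cascade-side imports). [folklore] -/
theorem isReal_of_conjL2_eq {u : L2C} (h : conjL2 u = u) : IsReal u := by
  unfold IsReal
  have h' := coeFn_conjL2 u
  rw [h] at h'
  filter_upwards [h'] with x hx
  intro i
  have hi := congrArg (fun z : ℂ³ => z i) hx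
  simp only [conj3_apply] at hi
  exact Complex.conj_eq_iff_im.1 hi.symm

/-- Two `L²` fields with a.e. equal Fourier transforms are equal (Plancherel injectivity).
Private copy of `Literature.Analysis.FluidPDE.Tao2016.eq_of_fourierFn_ae_eq`
(`TaoCascadeProjection.lean`, whose cascade-side imports are unwanted here). [folklore] -/
private theorem lp_eq_of_fourierFn_ae_eq {u v : L2C} (h : fourierFn u =ᵐ[volume] fourierFn v) : u = v :=
  (Lp.fourierTransformₗᵢ ℝ³ ℂ³).injective (Lp.ext h)

/-- The Fourier transform of `m(D) u` for a genuine symbol `m ∈ L^∞`: `m û` a.e. [cite: Tao2016AveragedNS, §1.1 p. 6] -/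
theorem fourierFn_fourierMultiplier_toLp {m : ℝ³ → ℂ} (hm : MemLp m ∞ (volume : Measure ℝ³))
    (u : L2C) :
    fourierFn (fourierMultiplier (hm.toLp m) u) =ᵐ[volume] fun ξ => m ξ • fourierFn u ξ := by
  filter_upwards [fourierFn_fourierMultiplier (hm.toLp m) u, hm.coeFn_toLp] with ξ h1 h2
  rw [h1, h2]

/-- **A real Fourier multiplier maps real fields to real fields** (Tao 2016, p. 6: "if the
symbol `m` obeys the symmetry `m(-ξ) = \overline{m(ξ)}` for all `ξ ∈ ℝ³ ∖ {0}`, then `m(D)`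
maps `H¹⁰_df(ℝ³)` to itself"): with `f = m(D)u`,
`\widehat{f̄}(ξ) = \overline{f̂(-ξ)} = \overline{m(-ξ)} \overline{û(-ξ)} = m(ξ) \widehat{ū}(ξ) = f̂(ξ)`,
so `f̄ = f` by Plancherel injectivity. [cite: Tao2016AveragedNS, §1.1 p. 6] -/
theorem IsReal.fourierMultiplier {u : L2C} (hu : IsReal u) {m : ℝ³ → ℂ} (hm : IsRealSymbol m) :
    IsReal (fourierMultiplier (hm.memLp_top.toLp m) u) := by
  refine isReal_of_conjL2_eq (lp_eq_of_fourierFn_ae_eq ?_)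
  have hq := (Measure.measurePreserving_neg (volume : Measure ℝ³)).quasiMeasurePreserving
  have h0 : ∀ᵐ ξ ∂(volume : Measure ℝ³), ξ ≠ 0 :=
    compl_mem_ae_iff.mpr (measure_singleton _)
  have hu' := fourierFn_conjL2 u
  rw [hu.conjL2_eq] at hu'
  filter_upwards [fourierFn_conjL2 (Tao2016.fourierMultiplier (hm.memLp_top.toLp m) u),
    hq.ae (fourierFn_fourierMultiplier_toLp hm.memLp_top u),
    fourierFn_fourierMultiplier_toLp hm.memLp_top u, hu', h0] with ξ h1 h2 h3 h4 h5
  rw [h1, h2, h3, conj3_smul, hm.2.2 ξ h5, Complex.conj_conj, h4]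

/-- **A real order-`0` multiplier maps `H¹⁰_df(ℝ³)` to itself** (Tao 2016, p. 6). [cite: Tao2016AveragedNS, §1.1 p. 6] -/
theorem MemH10df.fourierMultiplier {u : L2C} (hu : MemH10df u) {m : ℝ³ → ℂ}
    (hm : IsRealSymbol m) : MemH10df (fourierMultiplier (hm.memLp_top.toLp m) u) :=
  ⟨(hu.memH10dfC.fourierMultiplier _).1, hu.2.1.fourierMultiplier hm,
    (hu.memH10dfC.fourierMultiplier _).2⟩

end Literature.Analysis.FluidPDE.Tao2016
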